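import Mathlib
import Summits.Ventures.PercRepro2.Defs
import Summits.Ventures.PercRepro2.Independence
import Summits.Ventures.PercRepro2.Harris
import Summits.Ventures.PercRepro2.Graph
import Summits.Ventures.PercRepro2.Events
import Summits.Ventures.PercRepro2.ZCLeafBuilt

/-!
# (ZC) on every finite forest — as a statement about graphs
(blind cell PercRepro2, mine-a g24; MINE-A.md §71: the tree theorem without the strip list)

`zc_of_leafBuilt` (ZCLeafBuilt.lean) proves (ZC) for every weight vector supported on a LEAF-BUILT
edge list.  Here the combinatorial remark «every finite forest is leaf-built» is formalised:

* `exists_leaf_of_isAcyclic` — a finite acyclic simple graph with an edge has a vertex whose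
  neighbour is unique (a leaf): extend a path at its end as long as the end has a second
  neighbour; acyclicity keeps the new vertex off the path (`IsAcyclic.eq_penultimate_of_adj_end`),
  so the lengths would exceed `Fintype.card V`;
* `exists_stripList` — for a finite set `S` of edges without loops or parallel edges whose
  simple graph is acyclic, there is a strip list in the sense of `zc_of_leafBuilt` carrying
  exactly the edges of `S` (strong induction on `S`: strip a leaf edge, recurse);
* `zc_of_forest_support` — (ZC) for every weight vector whose positive-weight edges form a
  forest (no loops, no parallel edges, `openGraph ends (support)` acyclic), all marks (distinct or
  not) and every cluster up-set;
* `zc_of_forest` / `zc_of_tree` — the case of a simple forest / tree on all of `E`.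

No definition is introduced; std axioms.  One seat.
-/

namespace Summit.Ventures.PercRepro2

section Leaf

variable {V : Type*} [Fintype V]

/-- **A finite acyclic graph with an edge has a leaf**: a vertex `ℓ` with a neighbour `z` such that
every neighbour of `ℓ` is `z`.  Proof: otherwise every path can be extended at its end (the end has
a neighbour other than the penultimate vertex, which is off the path by acyclicity), giving paths of
every length — impossible in a finite graph. -/
lemma exists_leaf_of_isAcyclic {G : SimpleGraph V} (hG : G.IsAcyclic) {u v : V} (huv : G.Adj u v) :
    ∃ ℓ z, G.Adj ℓ z ∧ ∀ x, G.Adj ℓ x → x = z := by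
  by_contra hcon
  have hcon : ∀ ℓ z, G.Adj ℓ z → ∃ x, G.Adj ℓ x ∧ x ≠ z := by
    intro ℓ z h
    by_contra h'
    exact hcon ⟨ℓ, z, h, fun x hx => by
      by_contra hne
      exact h' ⟨x, hx, hne⟩⟩
  have key : ∀ n : ℕ, ∃ (w : V) (p : G.Walk u w), p.IsPath ∧ p.length = n + 1 := by
    intro n
    induction n with
    | zero =>
      refine ⟨v, SimpleGraph.Walk.cons huv SimpleGraph.Walk.nil, ?_, rfl⟩
      rw [SimpleGraph.Walk.cons_isPath_iff]
      exact ⟨SimpleGraph.Walk.IsPath.nil, by simp [huv.ne]⟩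
    | succ n ih =>
      obtain ⟨w, p, hp, hlen⟩ := ih
      have hnil : ¬ p.Nil := by
        rw [← SimpleGraph.Walk.length_eq_zero_iff, hlen]
        exact Nat.succ_ne_zero n
      obtain ⟨x, hx, hxne⟩ := hcon w p.penultimate (SimpleGraph.Walk.adj_penultimate hnil).symm
      have hxs : x ∉ p.support := fun hxs => hxne (hG.eq_penultimate_of_adj_end hp hx hxs)
      exact ⟨x, p.concat hx, hp.concat hxs hx, by rw [SimpleGraph.Walk.length_concat, hlen]⟩
  obtain ⟨w, p, hp, hlen⟩ := key (Fintype.card V)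
  have := hp.length_lt
  omega

end Leaf

section Strip

variable {V : Type*} [Fintype V] {E : Type*} [DecidableEq E]

/-- **Every finite forest is leaf-built.**  For a finite set `S` of edges without loops
(`¬ (ends e).IsDiag`) and without parallel edges (`ends` injective on `S`) whose simple graph
`SimpleGraph.fromRel (fun a b => ∃ e ∈ S, ends e = s(a, b))` is acyclic, there is a list of triples
`(f, z, ℓ)` in strip order — `ends f = s(z, ℓ)`, `z ≠ ℓ`, earlier leaves untouched by later edges —
whose edges are exactly those of `S`.  Strong induction on `S`: strip the edge at a leaf
(`exists_leaf_of_isAcyclic`) and recurse on the rest. -/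
lemma exists_stripList (ends : E → Sym2 V) (S : Finset E)
    (hloop : ∀ e ∈ S, ¬ (ends e).IsDiag)
    (hinj : ∀ e ∈ S, ∀ e' ∈ S, ends e = ends e' → e = e')
    (hacyc : (SimpleGraph.fromRel fun a b => ∃ e ∈ S, ends e = s(a, b)).IsAcyclic) :
    ∃ L : List (E × V × V), L.Pairwise (fun a b => a.1 ≠ b.1 ∧ a.2.2 ∉ ends b.1) ∧
      (∀ t ∈ L, ends t.1 = s(t.2.1, t.2.2) ∧ t.2.1 ≠ t.2.2) ∧
      (∀ e, e ∈ L.map Prod.fst ↔ e ∈ S) := by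
  induction S using Finset.strongInduction with
  | H S ih =>
    rcases S.eq_empty_or_nonempty with rfl | ⟨e₀, he₀⟩
    · exact ⟨[], List.Pairwise.nil, by simp, by simp⟩
    -- an edge of `S` gives an adjacency of the simple graph
    obtain ⟨u, v, huv⟩ : ∃ u v, ends e₀ = s(u, v) := Sym2.ind (fun x y => ⟨x, y, rfl⟩) (ends e₀)
    have hne : u ≠ v := fun h => hloop e₀ he₀ (by rw [huv, Sym2.mk_isDiag_iff]; exact h)
    have hadj : (SimpleGraph.fromRel fun a b => ∃ e ∈ S, ends e = s(a, b)).Adj u v :=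
      (SimpleGraph.fromRel_adj _ _ _).2 ⟨hne, Or.inl ⟨e₀, he₀, huv⟩⟩
    -- a leaf `ℓ` with its unique neighbour `z`, and the edge `f` between them
    obtain ⟨ℓ, z, hℓz, huniq⟩ := exists_leaf_of_isAcyclic hacyc hadj
    obtain ⟨hℓz', hf⟩ := (SimpleGraph.fromRel_adj _ _ _).1 hℓz
    obtain ⟨f, hfS, hfends⟩ : ∃ f ∈ S, ends f = s(z, ℓ) := by
      rcases hf with ⟨f, hfS, h⟩ | ⟨f, hfS, h⟩
      · exact ⟨f, hfS, by rw [h, Sym2.eq_swap]⟩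
      · exact ⟨f, hfS, h⟩
    -- the rest of the edges
    have hsub : S.erase f ⊂ S := Finset.erase_ssubset hfS
    have hloop' : ∀ e ∈ S.erase f, ¬ (ends e).IsDiag :=
      fun e he => hloop e (Finset.mem_of_mem_erase he)
    have hinj' : ∀ e ∈ S.erase f, ∀ e' ∈ S.erase f, ends e = ends e' → e = e' :=
      fun e he e' he' h => hinj e (Finset.mem_of_mem_erase he) e' (Finset.mem_of_mem_erase he') h
    have hacyc' : (SimpleGraph.fromRel fun a b => ∃ e ∈ S.erase f, ends e = s(a, b)).IsAcyclic := by
      refine hacyc.anti ?_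
      intro a b hab
      rw [SimpleGraph.fromRel_adj] at hab ⊢
      obtain ⟨hab, h⟩ := hab
      refine ⟨hab, ?_⟩
      rcases h with ⟨e, he, h⟩ | ⟨e, he, h⟩
      · exact Or.inl ⟨e, Finset.mem_of_mem_erase he, h⟩
      · exact Or.inr ⟨e, Finset.mem_of_mem_erase he, h⟩
    obtain ⟨L', hpair', hends', hmem'⟩ := ih (S.erase f) hsub hloop' hinj' hacyc'
    refine ⟨(f, z, ℓ) :: L', ?_, ?_, ?_⟩
    · -- strip order: `f` differs from the later edges and `ℓ` is on none of them
      refine List.pairwise_cons.2 ⟨fun b hb => ?_, hpair'⟩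
      have hbS' : b.1 ∈ S.erase f := (hmem' b.1).1 (List.mem_map_of_mem hb)
      have hbf : b.1 ≠ f := Finset.ne_of_mem_erase hbS'
      have hbS : b.1 ∈ S := Finset.mem_of_mem_erase hbS'
      refine ⟨hbf.symm, fun hmem => hbf ?_⟩
      -- `ends b.1 = s(ℓ, x)`; `x ≠ ℓ`; so `x` is a neighbour of `ℓ`, hence `x = z`, hence `b.1 = f`
      have hx := Sym2.other_spec hmem
      have hxℓ : ℓ ≠ Sym2.Mem.other hmem := fun h =>
        hloop b.1 hbS (by rw [← hx, Sym2.mk_isDiag_iff]; exact h)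
      have hadjx : (SimpleGraph.fromRel fun a b => ∃ e ∈ S, ends e = s(a, b)).Adj ℓ
          (Sym2.Mem.other hmem) :=
        (SimpleGraph.fromRel_adj _ _ _).2 ⟨hxℓ, Or.inl ⟨b.1, hbS, hx.symm⟩⟩
      have hxz := huniq _ hadjx
      refine hinj b.1 hbS f hfS ?_
      rw [← hx, hxz, hfends, Sym2.eq_swap]
    · intro t ht
      rcases List.mem_cons.1 ht with rfl | ht
      · exact ⟨hfends, Ne.symm hℓz'⟩
      · exact hends' t ht
    · intro e
      simp only [List.map_cons, List.mem_cons]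
      rw [hmem' e, Finset.mem_erase]
      constructor
      · rintro (rfl | ⟨_, h⟩)
        · exact hfS
        · exact h
      · intro h
        by_cases hef : e = f
        · exact Or.inl hef
        · exact Or.inr ⟨hef, h⟩

end Strip

section Forest

variable {V : Type*} [Fintype V] [DecidableEq V] {E : Type*} [Fintype E] [DecidableEq E]
  {R : Type*} [CommRing R] [LinearOrder R] [IsStrictOrderedRing R]

/-- **(ZC) when the positive-weight edges form a forest.**  If the edges of positive weight carry no
loop and no parallel pair, and the open graph of the configuration «every positive-weight edge
open» is acyclic, then (ZC) holds for every choice of the marks (distinct or not) and every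
cluster up-set.  `exists_stripList` on `S = {e ∣ p e ≠ 0}` followed by `zc_of_leafBuilt`. -/
theorem zc_of_forest_support (ends : E → Sym2 V) (p : E → R) (hp : IsProbVec p)
    (hloop : ∀ e, p e ≠ 0 → ¬ (ends e).IsDiag)
    (hinj : ∀ e e', p e ≠ 0 → p e' ≠ 0 → ends e = ends e' → e = e')
    (hacyc : (openGraph ends (fun e => decide (p e ≠ 0))).IsAcyclic)
    (a₁ a₃ o : V) (𝓔 : Set (Set V)) (h𝓔 : IsUpperSet 𝓔) :
    let e := connEvent ends a₁ a₃
    let L' := connEvent ends a₁ o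
    let U := clusterInEvent ends a₁ 𝓔
    let γ := connEvent ends a₃ o
    0 ≤ prob p (eᶜ ∩ L'ᶜ ∩ γᶜ) * (prob p (U ∩ (e ∩ L')) - prob p U * prob p (e ∩ L'))
      - prob p (eᶜ ∩ L'ᶜ ∩ γ) * (prob p (U ∩ (e ∩ L'ᶜ)) - prob p U * prob p (e ∩ L'ᶜ)) := by
  intro e L' U γ
  set S : Finset E := Finset.univ.filter (fun e => p e ≠ 0) with hS
  have hS_mem : ∀ e, e ∈ S ↔ p e ≠ 0 := by
    intro e; simp [hS]
  have hacyc' : (SimpleGraph.fromRel fun a b => ∃ e ∈ S, ends e = s(a, b)).IsAcyclic := by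
    refine hacyc.anti ?_
    intro a b hab
    rw [SimpleGraph.fromRel_adj] at hab
    rw [openGraph_adj]
    obtain ⟨hne, h⟩ := hab
    refine ⟨hne, ?_⟩
    rcases h with ⟨e, he, h⟩ | ⟨e, he, h⟩
    · exact ⟨e, by simpa using (hS_mem e).1 he, h⟩
    · exact ⟨e, by simpa using (hS_mem e).1 he, by rw [h, Sym2.eq_swap]⟩
  obtain ⟨L, hpair, hends, hmem⟩ := exists_stripList ends S
    (fun e he => hloop e ((hS_mem e).1 he))
    (fun e he e' he' h => hinj e e' ((hS_mem e).1 he) ((hS_mem e').1 he') h) hacyc'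
  have := zc_of_leafBuilt (ends := ends) L hpair hends p hp
    (fun e he => (hmem e).2 ((hS_mem e).2 he)) a₁ a₃ o 𝓔 h𝓔
  simpa using this

/-- **(ZC) on every finite simple forest**: `ends` without loops and injective (no parallel edges),
the graph with every edge open acyclic — then (ZC) holds for every weight vector, every choice of
the marks and every cluster up-set. -/
theorem zc_of_forest (ends : E → Sym2 V) (hloop : ∀ e, ¬ (ends e).IsDiag)
    (hinj : Function.Injective ends) (hacyc : (openGraph ends (fun _ => true)).IsAcyclic)
    (p : E → R) (hp : IsProbVec p) (a₁ a₃ o : V) (𝓔 : Set (Set V)) (h𝓔 : IsUpperSet 𝓔) :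
    let e := connEvent ends a₁ a₃
    let L' := connEvent ends a₁ o
    let U := clusterInEvent ends a₁ 𝓔
    let γ := connEvent ends a₃ o
    0 ≤ prob p (eᶜ ∩ L'ᶜ ∩ γᶜ) * (prob p (U ∩ (e ∩ L')) - prob p U * prob p (e ∩ L'))
      - prob p (eᶜ ∩ L'ᶜ ∩ γ) * (prob p (U ∩ (e ∩ L'ᶜ)) - prob p U * prob p (e ∩ L'ᶜ)) := by
  intro e L' U γ
  refine zc_of_forest_support ends p hp (fun e _ => hloop e) (fun e e' _ _ h => hinj h) ?_
    a₁ a₃ o 𝓔 h𝓔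
  refine hacyc.anti ?_
  intro a b hab
  rw [openGraph_adj] at hab ⊢
  obtain ⟨hne, e, _, h⟩ := hab
  exact ⟨hne, e, rfl, h⟩

/-- **(ZC) on every finite tree** (`SimpleGraph.IsTree` of the all-open graph): the forest theorem. -/
theorem zc_of_tree (ends : E → Sym2 V) (hloop : ∀ e, ¬ (ends e).IsDiag)
    (hinj : Function.Injective ends) (htree : (openGraph ends (fun _ => true)).IsTree)
    (p : E → R) (hp : IsProbVec p) (a₁ a₃ o : V) (𝓔 : Set (Set V)) (h𝓔 : IsUpperSet 𝓔) :
    let e := connEvent ends a₁ a₃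
    let L' := connEvent ends a₁ o
    let U := clusterInEvent ends a₁ 𝓔
    let γ := connEvent ends a₃ o
    0 ≤ prob p (eᶜ ∩ L'ᶜ ∩ γᶜ) * (prob p (U ∩ (e ∩ L')) - prob p U * prob p (e ∩ L'))
      - prob p (eᶜ ∩ L'ᶜ ∩ γ) * (prob p (U ∩ (e ∩ L'ᶜ)) - prob p U * prob p (e ∩ L'ᶜ)) :=
  zc_of_forest ends hloop hinj htree.isAcyclic p hp a₁ a₃ o 𝓔 h𝓔

end Forest

end Summit.Ventures.PercRepro2
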